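import Summits.Ventures.HodgeRepro2.T4Parity

/-!
# T5Reciprocity — Hilbert reciprocity narrows the residual [G-N2.1] (seat p3, Tier-5 support for N2)

Cell `pub-hodge-repro2`, README §7. Route-3's Lemma N.1 (necessity of `W₃₄ ≅ W₁₂` for (N)) is proved
place by place: the local selection rule at the non-split finite places `v ∤ 2`, nothing at the split places,
the signatures at the real places — and at the non-split DYADIC places the printed input (Sun–Zhu Thm 1.10)
is not held in print: residual [G-N2.1]. This file records the arithmetic that removes the residual whenever
at most ONE dyadic place of `F⁺` is non-split in `F`: in the cell's `LocalSymbols` model (`T4GroupData`: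
`χ_v : G_v →* ℤˣ` = the local Hilbert symbol `(·, θ)_v`, `symbolProd d = ∏ᶠ_v χ_v(d_v)`), Hilbert
reciprocity (O'Meara 71:18 — the hypothesis `symbolProd d = 1` for the principal idèle of
`c := d₀(W₃₄)/d₀(W₁₂)`) together with «`χ_v(c) = 1` outside `D`» forces `χ_v(c) = 1` at the places of `D`
too when `|D| ≤ 1`, i.e. `W₁₂,v ≅ W₃₄,v` at EVERY place (Shimura 2008 Lemma 1.6 / O'Meara §65A (N2)); in
general the number of bad places inside `D` is EVEN. Prose: `route/T5-SUPPORT-p3.md` §9.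
-/

namespace Summit.Ventures.HodgeRepro2.T4GroupData.LocalSymbols

variable {ι : Type*} {G : ι → Type*} [∀ v, CommGroup (G v)] (S : LocalSymbols ι G)

/-- If every symbol outside `D` is trivial, the non-norm set `T(d) = {v ∣ χ_v(d_v) = −1}` lies in `D`. -/
theorem nonNormSet_subset_of_forall_notMem (d : ∀ v, G v) (D : Set ι)
    (h : ∀ v, v ∉ D → S.χ v (d v) = 1) : S.nonNormSet d ⊆ D := by
  intro v hv
  by_contra hvD
  have h1 := h v hvD
  have h2 : S.χ v (d v) = -1 := hv
  rw [h1] at h2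
  exact absurd h2 (by decide)

/-- Hilbert reciprocity as the hypothesis `symbolProd d = 1` (O'Meara 71:18 for a principal idèle): the
number of places with symbol `−1` is EVEN. -/
theorem even_ncard_nonNormSet_of_symbolProd_eq_one (d : ∀ v, G v) (hfin : (S.nonNormSet d).Finite)
    (hprod : S.symbolProd d = 1) : Even (S.nonNormSet d).ncard := by
  have hfs := (S.nonNormSet_finite_iff d).mp hfin
  have h1 := S.symbolProd_eq_neg_one_pow_ncard d hfs
  rw [hprod] at h1
  by_contra hodd
  rw [Nat.not_even_iff_odd] at hodd
  have h2 := (intUnits_neg_one_pow_eq_neg_one_iff _).mpr hodd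
  exact absurd (h1.trans h2) (by decide)

/-- THE NARROWING: symbols trivial outside a finite set `D` with `|D| ≤ 1`, and the product formula
`symbolProd d = 1` ⟹ every symbol is trivial (the one possible bad place cannot be bad alone). -/
theorem χ_eq_one_of_symbolProd_eq_one_of_ncard_le_one (d : ∀ v, G v) (D : Set ι) (hD : D.Finite)
    (hD1 : D.ncard ≤ 1) (h : ∀ v, v ∉ D → S.χ v (d v) = 1) (hprod : S.symbolProd d = 1) :
    ∀ v, S.χ v (d v) = 1 := by
  have hsub := S.nonNormSet_subset_of_forall_notMem d D h
  have hfin : (S.nonNormSet d).Finite := hD.subset hsub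
  have hle : (S.nonNormSet d).ncard ≤ D.ncard := Set.ncard_le_ncard hsub hD
  have heven := S.even_ncard_nonNormSet_of_symbolProd_eq_one d hfin hprod
  have hzero : (S.nonNormSet d).ncard = 0 := by
    rcases heven with ⟨k, hk⟩
    omega
  have hempty : S.nonNormSet d = ∅ := (Set.ncard_eq_zero hfin).mp hzero
  intro v
  by_contra hne
  have hmem : v ∈ S.nonNormSet d := (intUnits_eq_neg_one_iff_ne_one _).mpr hne
  rw [hempty] at hmem
  exact hmem

/-- The same with `D = {v₀}`: a single candidate bad place is never bad. -/
theorem χ_eq_one_of_symbolProd_eq_one_of_single (d : ∀ v, G v) (v₀ : ι)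
    (h : ∀ v, v ≠ v₀ → S.χ v (d v) = 1) (hprod : S.symbolProd d = 1) : ∀ v, S.χ v (d v) = 1 :=
  S.χ_eq_one_of_symbolProd_eq_one_of_ncard_le_one d {v₀} (Set.finite_singleton v₀)
    (by simp) (fun v hv => h v (by simpa using hv)) hprod

/-- With `|D| = 3` (2 split completely in `F⁺`, all three dyadic places non-split in `F`) reciprocity
only says: `0` or `2` of them are bad — the residual case of [G-N2.1], stated exactly. -/
theorem ncard_nonNormSet_eq_zero_or_two_of_ncard_le_three (d : ∀ v, G v) (D : Set ι) (hD : D.Finite)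
    (hD3 : D.ncard ≤ 3) (h : ∀ v, v ∉ D → S.χ v (d v) = 1) (hprod : S.symbolProd d = 1) :
    (S.nonNormSet d).ncard = 0 ∨ (S.nonNormSet d).ncard = 2 := by
  have hsub := S.nonNormSet_subset_of_forall_notMem d D h
  have hfin : (S.nonNormSet d).Finite := hD.subset hsub
  have hle : (S.nonNormSet d).ncard ≤ D.ncard := Set.ncard_le_ncard hsub hD
  have heven := S.even_ncard_nonNormSet_of_symbolProd_eq_one d hfin hprod
  rcases heven with ⟨k, hk⟩
  omega

end Summit.Ventures.HodgeRepro2.T4GroupData.LocalSymbols
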